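import Literature.IUT.HodgeTheaters.PiAvatarBaseKitConsumers
import HarnessLib

/-!
# The genuine [IUTchI] §6 base kit with its binders MINIMISED and NAMED: `baseKitOfTorsionMonodromy` — torsion monodromy `M`
# (⇒ `[Normal]`, `toFlStar` surjective, (L1) at good places), t1's §1 claims `hA`, the (rel)-type law `hI`, the good-place SIGN law,
# the bad-pair DATA `B` with its local arrow laws ([IUTchI] Def 6.1; one def + laws — post-freeze additive D13, not a cone member)

S. Mochizuki, *Inter-universal Teichmüller theory I*, kurims manuscript (May 2020), Def 6.1 (ii)–(vii) pp. 156–159, Ex 6.3 (i)(ii) p. 161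
([IUTchI] Def 6.1 (ii)-(vii) pp.156-159) [claim: Mochizuki2012, status: disputed] (D-0012 claim key, series status DISPUTED — a packaging of abc-iut-L5-t4's
construction `InitialThetaData.baseKit` (p445979) over abc-iut-L5-t2's REAL `InitialThetaData`, abc-iut-L5-t8's `TorsionMonodromy` (p433356/p433603)
and abc-iut-L5-d5's (L1)-discharge (p445209); nothing of the series is asserted, no side is taken on [IUTchIII] Cor. 3.12).

## What is built (for the CERT bank: the binder list of the genuine kit, per place-CLASS)
* `localArrowLawFamilyOfTorsionMonodromy M hA hI B hsign ΛBad : ∀ v, D.LocalArrowLaw CG hS (D.localGroupAt B v)` — GOOD indices: (L1) is the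
  THEOREM `TorsionMonodromy.localArrowLaw_L1_local` (d5), (L2) the sign binder `hsign`; BAD indices: the law `ΛBad v h` of the pair's `H`.
* **`baseKitOfTorsionMonodromy M hA hI B hsign ΛBad : PMBaseKit.{w} l`** := `baseKit` with `[Normal] := M.normal_PiXund_subgroupOf_PiXK`,
  `hsurj := toFlStarGlobal_surjective_of_torsionMonodromy M` (t8), `Λ :=` the family above. BINDERS, exhaustively: `CG` (cusp/Galois DATA, t1),
  `hS` (G-L5t4g3-3), `M : D.TorsionMonodromy` (NV #45), `hA : ArrowCoveringClaims` (t1), `hI` (cusp inertia of `ε′` is `τ`-invisible; G-L5d5g6-1),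
  `hsign` (Def 6.1 (iii) sign law at GOOD places — (L2), open), `B` (bad-pair DATA, G-L5t4g3-2 (iii)), `ΛBad` (local arrow law at BAD places).
* (α) `phiEllSync_baseKitOfTorsionMonodromy`, (β) `negCompatModel_baseKitOfTorsionMonodromy`, and Prop 6.6 (ii)(iii) / 6.8 (i) / Ex 6.3 (ii) at it.
No instance declared (the `Normal` instance is supplied locally by `haveI`), no notation; typed ≠ inhabited ≠ proved; binders ≠ facts.
-/

noncomputable section

namespace Literature.IUT.HodgeTheaters

open CategoryTheory

universe u v w

section BaseKitOfTorsionMonodromy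

variable {F : Type u} {K : Type v} {Fbar : Type w} [Field F] [NumberField F] [Field K] [NumberField K]
  [Algebra F K] [Field Fbar] [Algebra F Fbar] [Algebra K Fbar]
  {E : WeierstrassCurve F} [E.IsElliptic] {l : ℕ} {Pb : BadPlacePredicates K}
  (D : InitialThetaData F K Fbar E l Pb) (CG : D.geom.pe.CuspGalois) (hS : D.CuspClassesNormaliserStable) [Fact l.Prime]
  (M : D.TorsionMonodromy) (hA : D.geom.pe.ArrowCoveringClaims)
  (hI : ∀ k ∈ D.geom.pe.inertia D.geom.pe.ε1, M.tau (D.geom.embK k) = 0)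
  (B : ∀ v, v ∈ D.indexCopyBad → D.BadPairAt v)
  (hsign : ∀ v : D.IndexCopy, v ∉ D.indexCopyBad → ∀ n : D.PiC,
    n ∈ Subgroup.normalizer ((D.PiXarrow ⊓ (D.decompAt v).comap D.augGF : Subgroup D.PiC) : Set D.PiC) →
      ∀ hn : n ∈ Subgroup.normalizer ((D.PiXund : Subgroup D.PiC) : Set D.PiC),
        ∃ ε : ℤˣ, ∀ x, D.gChart₀Model CG (D.actF CG hS ⟨n, hn⟩ x) = ε • D.gChart₀Model CG x)
  (ΛBad : ∀ v (h : v ∈ D.indexCopyBad), D.LocalArrowLaw CG hS (B v h).H)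

namespace InitialThetaData

include M hA hI hsign ΛBad in
open Classical in
/-- **The local-arrow-law family of the genuine kit from its minimal binders**: at good indices (L1) is d5's theorem and (L2) the sign binder;
at bad indices the given law of the pair. ([IUTchI] Def 6.1 (iii) p.157) [claim: Mochizuki2012, status: disputed] -/
theorem localArrowLawFamilyOfTorsionMonodromy (v : D.IndexCopy) : D.LocalArrowLaw CG hS (D.localGroupAt B v) := by
  by_cases h : v ∈ D.indexCopyBad
  · rw [D.localGroupAt_of_mem B h]
    exact ΛBad v h
  · rw [D.localGroupAt_of_not_mem B h]
    exact D.localArrowLaw_good_of_torsionMonodromy CG hS M hA hI (D.decompAt v) (hsign v h)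

/-- **THE GENUINE BASE KIT WITH MINIMAL NAMED BINDERS** (`baseKit` at `[Normal] := M.normal_PiXund_subgroupOf_PiXK`,
`hsurj := toFlStarGlobal_surjective_of_torsionMonodromy M`, `Λ :=` the family above). ([IUTchI] Def 6.1 (ii)-(vii) pp.156-159) [claim: Mochizuki2012, status: disputed] -/
def baseKitOfTorsionMonodromy : PMBaseKit.{w} l :=
  haveI := M.normal_PiXund_subgroupOf_PiXK
  D.baseKit B CG hS (D.toFlStarGlobal_surjective_of_torsionMonodromy M) hA
    (D.localArrowLawFamilyOfTorsionMonodromy CG hS M hA hI B hsign ΛBad)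

/-- **(α) `PhiEllSync`** at the minimally-bound genuine kit. ([IUTchI] Ex 6.3 (i) p.161) [claim: Mochizuki2012, status: disputed] -/
theorem phiEllSync_baseKitOfTorsionMonodromy :
    PMBaseKit.Ex63.PhiEllSync (D.baseKitOfTorsionMonodromy CG hS M hA hI B hsign ΛBad) := by
  haveI := M.normal_PiXund_subgroupOf_PiXK
  exact D.phiEllSync_baseKit B CG hS _ hA _

/-- **(β) `NegCompatModel`** at the minimally-bound genuine kit. ([IUTchI] Ex 6.3 (ii) p.161) [claim: Mochizuki2012, status: disputed] -/
theorem negCompatModel_baseKitOfTorsionMonodromy :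
    PMBaseKit.Ex63.NegCompatModel (D.baseKitOfTorsionMonodromy CG hS M hA hI B hsign ΛBad) := by
  haveI := M.normal_PiXund_subgroupOf_PiXK
  exact D.negCompatModel_baseKit B CG hS _ hA _

/-- **[IUTchI] Prop 6.6 (ii)** at the minimally-bound genuine kit. ([IUTchI] Prop 6.6 (ii) p.165) [claim: Mochizuki2012, status: disputed] -/
theorem isoTorsor_thetaEllBridge_baseKitOfTorsionMonodromy
    (B₁ B₂ : (D.baseKitOfTorsionMonodromy CG hS M hA hI B hsign ΛBad).DThetaEllBridge) :
    PMBaseKit.DThetaEllBridge.IsoTorsor B₁ B₂ :=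
  PMBaseKit.DThetaEllBridge.isoTorsor_of_negCompatModel (D.negCompatModel_baseKitOfTorsionMonodromy CG hS M hA hI B hsign ΛBad) B₁ B₂

/-- **[IUTchI] Prop 6.6 (iii)** at the minimally-bound genuine kit. ([IUTchI] Prop 6.6 (iii) p.165) [claim: Mochizuki2012, status: disputed] -/
theorem isoTorsor_thetaPMEllHT_baseKitOfTorsionMonodromy
    (H₁ H₂ : (D.baseKitOfTorsionMonodromy CG hS M hA hI B hsign ΛBad).DThetaPMEllHT) :
    PMBaseKit.DThetaPMEllHT.IsoTorsor H₁ H₂ :=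
  PMBaseKit.DThetaPMEllHT.isoTorsor_of_negCompatModel (D.negCompatModel_baseKitOfTorsionMonodromy CG hS M hA hI B hsign ΛBad) H₁ H₂

/-- **[IUTchI] Prop 6.8 (i)** at the minimally-bound genuine kit. ([IUTchI] Prop 6.8 (i) p.167) [claim: Mochizuki2012, status: disputed] -/
theorem ellBridgeSymmetry_baseKitOfTorsionMonodromy (H : (D.baseKitOfTorsionMonodromy CG hS M hA hI B hsign ΛBad).DThetaPMEllHT) :
    PMBaseKit.DThetaPMEllHT.EllBridgeSymmetry H :=
  PMBaseKit.DThetaPMEllHT.ellBridgeSymmetry_of_negCompatModel (D.negCompatModel_baseKitOfTorsionMonodromy CG hS M hA hI B hsign ΛBad) H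

/-- **[IUTchI] Ex 6.3 (ii)** (negative `γ`) at the minimally-bound genuine kit. ([IUTchI] Ex 6.3 (ii) p.161) [claim: Mochizuki2012, status: disputed] -/
theorem equivariant_baseKitOfTorsionMonodromy {γ : FlPM l} (hγ : γ.IsNegative) :
    PMBaseKit.Ex63.Equivariant (D.baseKitOfTorsionMonodromy CG hS M hA hI B hsign ΛBad) γ :=
  (D.negCompatModel_baseKitOfTorsionMonodromy CG hS M hA hI B hsign ΛBad).equivariant hγ

end InitialThetaData

end BaseKitOfTorsionMonodromy

end Literature.IUT.HodgeTheaters
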